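/-
Summits/MatrixMultiplication/MatrixMultiplication/Theorems/TetraResidualNecessityCut.lean
decomp-mm lens 6 («barrier-complement carving»), generation 28 — supports item 27058 (TetraPlusTwo,
the declared residual of route TetrahedronCarving).  Part 4b: the cut inside the model; finiteness.
-/
import Summits.MatrixMultiplication.MatrixMultiplication.Theorems.TetraResidualNecessitySharp

/-!
# Residual necessity, part 4b: the cut of record inside the model; finiteness is sharp

* §8 **the cut of record reproduced inside the model** (`cut_forces_cap`, `cut_forces`): the
  faithful pieces `ExcessZero : sval 𝟙 ≤ sval (1,2,2,0,0,0)` (`ω(K₄) ≤ ω(2,1,2)`, the weighted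
  triangle `⟨n²,n,n²⟩` on the legs `01,02,12`), `PlusTwo : sval tri + 2 ≤ sval 𝟙`
  (`ω + 2 ≤ ω(K₄)`) and ONE Coppersmith–Winograd value piece `AlphaCap a : sval (a,1,1,0,0,0) ≤ 2`
  (`ω(1,a,1) ≤ 2`, any `0 < a ≤ 1/2`) force `ω ≤ 2` in every tame world — the tree's glue
  `ω + 2 ≤ ω(K₄) ≤ ω(2,1,2) = 2·ω(1,½,1) ≤ 2[λ·ω(1,a,1) + (1-λ)·ω]`, the model supplying homogeneity
  and convexity of `u ↦ sval Δ u` for free.  The ω-free part `{ExcessZero, AlphaCap a}` is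
  necessary and stable and does NOT force (`excessZero_alphaCap_not_force`), and `PlusTwo` is the
  tight, unstable member (`plusTwo_unstable`): the model classifies the cut exactly as the route does
  (one attacked ω-free piece, one ω-bounding residual).  The diamond reading of part 3
  (`tetraExcessZeroData`, `ψ(1)` in place of `ω(2,1,2)`) follows from the faithful one by the tree's
  grouping law `ω(2,1,2) ≤ ψ(1)` (`groupingLawData`, `tetraExcessZero_of_excessZero`).
* §9 **finiteness is sharp** (`alphaFamily_forces_cap`): the INFINITE family
  `{ω(1,a,1) ≤ 2 : a < 1}` — every member necessary (`alphaCap_nec`) and stable (`alphaCap_stable`),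
  i.e. ω-free in the sense of parts 1–3 — forces `ω ≤ 2` in every world with `β₀₁ ≤ 1`; and it is
  `ω = 2` in costume (`alphaFamily_iff_cap`; its limit member `a = 1` is the cap itself, `k4ua_one`).
  `capFamily_forces_nearly_tight`: ANY family of caps true at `Δ₀` that forces `ω ≤ 2` has, for every
  small `ε > 0`, a member `ε`-tight at the exotic point and seeing `ω` — infinite ω-free families
  escape residual necessity only by accumulating tightness at the summit face.

Pure convex geometry over `Mathlib`; no tensor input, no `sorry`, no new axiom, no instance, no notation.
-/

open Filter Topology Set

namespace Summit.MatrixMultiplication.MatrixMultiplication.Theorems.TetraResidualNecessity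

/-! ### 8. The cut of record reproduced inside the model -/

section Cut

/-- `ω(2,1,2)` read on the triangle `012` as the weighted triangle `⟨n²,n,n²⟩`: legs `(1,2,2)` -/
def k4w122 : Fin 6 → ℝ := ![1, 2, 2, 0, 0, 0]

/-- `ω(1,a,1)`: the weighted triangle `(a,1,1)` on the legs `01,02,12` -/
def k4ua (a : ℝ) : Fin 6 → ℝ := ![a, 1, 1, 0, 0, 0]

/-- `TetraExcessZero : ω(K₄) ≤ ω(2,1,2)` read faithfully: `sval 𝟙 - sval (1,2,2,0,0,0) ≤ 0`
(part 3's `tetraExcessZeroData` reads `ω(2,1,2)` through the diamond `ψ(1) = sval (𝟙 - e₀₁)`; the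
two readings are linked by the grouping law `groupingLawData`) -/
def excessZeroData : LinData (Fin 6) := ⟨2, ![1, -1], ![k4one, k4w122], 0⟩

/-- the grouping law `ω(2,1,2) ≤ ψ(1)` (`EdgePencilExponent.omegaRect_two_mid_two_le_omegaPencil`):
`sval (1,2,2,0,0,0) - sval (𝟙 - e₀₁) ≤ 0` -/
def groupingLawData : LinData (Fin 6) := ⟨2, ![1, -1], ![k4w122, k4dia], 0⟩

/-- the Coppersmith–Winograd value piece `ω(1,a,1) ≤ 2` (true for `a ≤ α`, `α > 0.17`) -/
def alphaCapData (a : ℝ) : LinData (Fin 6) := ⟨1, ![1], ![k4ua a], 2⟩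

/-- unfolding of a two-term support-linear piece -/
theorem LinData.holds_two (c₁ c₂ r : ℝ) (u₁ u₂ : Fin 6 → ℝ) (Δ : Set (Fin 6 → ℝ)) :
    (⟨2, ![c₁, c₂], ![u₁, u₂], r⟩ : LinData (Fin 6)).holds Δ ↔
      c₁ * sval Δ u₁ + c₂ * sval Δ u₂ ≤ r := by
  change (∑ j : Fin 2, (![c₁, c₂] : Fin 2 → ℝ) j * sval Δ ((![u₁, u₂] : Fin 2 → Fin 6 → ℝ) j)) ≤ r
    ↔ _
  rw [Fin.sum_univ_two]
  simp only [Matrix.cons_val_zero, Matrix.cons_val_one]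

/-- unfolding of a one-term support-linear piece -/
theorem LinData.holds_one (c r : ℝ) (u : Fin 6 → ℝ) (Δ : Set (Fin 6 → ℝ)) :
    (⟨1, ![c], ![u], r⟩ : LinData (Fin 6)).holds Δ ↔ c * sval Δ u ≤ r := by
  change (∑ j : Fin 1, (![c] : Fin 1 → ℝ) j * sval Δ ((![u] : Fin 1 → Fin 6 → ℝ) j)) ≤ r ↔ _
  rw [Fin.sum_univ_one]
  simp only [Matrix.cons_val_zero]

/-- unfolding of `excessZeroData` -/
theorem excessZero_holds_iff (Δ : Set (Fin 6 → ℝ)) :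
    excessZeroData.holds Δ ↔ sval Δ k4one ≤ sval Δ k4w122 := by
  rw [show excessZeroData = ⟨2, ![1, -1], ![k4one, k4w122], 0⟩ from rfl, LinData.holds_two]
  constructor <;> intro h <;> linarith

/-- unfolding of `groupingLawData` -/
theorem groupingLaw_holds_iff (Δ : Set (Fin 6 → ℝ)) :
    groupingLawData.holds Δ ↔ sval Δ k4w122 ≤ sval Δ k4dia := by
  rw [show groupingLawData = ⟨2, ![1, -1], ![k4w122, k4dia], 0⟩ from rfl, LinData.holds_two]
  constructor <;> intro h <;> linarith

/-- unfolding of part 3's `tetraExcessZeroData` -/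
theorem tetraExcessZero_holds_iff (Δ : Set (Fin 6 → ℝ)) :
    tetraExcessZeroData.holds Δ ↔ sval Δ k4one ≤ sval Δ k4dia := by
  rw [show tetraExcessZeroData = ⟨2, ![1, -1], ![k4one, k4dia], 0⟩ from rfl, LinData.holds_two]
  constructor <;> intro h <;> linarith

/-- unfolding of `TetraPlusTwo = residualPencilData 1` -/
theorem plusTwo_holds_iff (Δ : Set (Fin 6 → ℝ)) :
    (residualPencilData 1).holds Δ ↔ sval Δ k4tri + 2 ≤ sval Δ k4one := by
  rw [show residualPencilData 1 = ⟨2, ![1, -1], ![k4tri, k4one], 2 * 1 - 4⟩ from rfl,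
    LinData.holds_two]
  constructor <;> intro h <;> linarith

/-- unfolding of `alphaCapData` -/
theorem alphaCap_holds_iff (a : ℝ) (Δ : Set (Fin 6 → ℝ)) :
    (alphaCapData a).holds Δ ↔ sval Δ (k4ua a) ≤ 2 := by
  rw [show alphaCapData a = ⟨1, ![1], ![k4ua a], 2⟩ from rfl, LinData.holds_one]
  constructor <;> intro h <;> linarith

/-- the faithful reading implies part 3's diamond reading, given the grouping law -/
theorem tetraExcessZero_of_excessZero {Δ : Set (Fin 6 → ℝ)} (hA : excessZeroData.holds Δ)
    (hG : groupingLawData.holds Δ) : tetraExcessZeroData.holds Δ := by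
  rw [excessZero_holds_iff] at hA
  rw [groupingLaw_holds_iff] at hG
  rw [tetraExcessZero_holds_iff]
  exact hA.trans hG

/-- **The cut of record forces, inside the model.**  In every tame world, `TetraExcessZero`
(faithful reading) `+ TetraPlusTwo + [ω(1,a,1) ≤ 2]` for ONE `0 < a ≤ 1/2` give `ω ≤ 2`: the tree's
glue `ω + 2 ≤ ω(K₄) ≤ ω(2,1,2) = 2·ω(1,½,1) ≤ 2[λ·ω(1,a,1) + (1-λ)·ω]`, `λ = 1/(2(1-a)) > 1/2`, with
homogeneity and convexity of `u ↦ sval Δ u` supplied by the model. -/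
theorem cut_forces_cap {Δ : Set (Fin 6 → ℝ)} (hΔ : Tame Δ) {a : ℝ} (ha0 : 0 < a)
    (ha1 : a ≤ 1 / 2) (hA : excessZeroData.holds Δ) (hB : (residualPencilData 1).holds Δ)
    (hα : (alphaCapData a).holds Δ) : Cap k4tri 2 Δ := by
  rw [excessZero_holds_iff] at hA
  rw [plusTwo_holds_iff] at hB
  rw [alphaCap_holds_iff] at hα
  have h1a : 0 < 1 - a := by linarith
  obtain ⟨l, hl, hl0, hl1⟩ : ∃ l : ℝ, l * (2 * (1 - a)) = 1 ∧ 1 / 2 < l ∧ l ≤ 1 := by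
    refine ⟨1 / (2 * (1 - a)), div_mul_cancel₀ 1 (ne_of_gt (by linarith)), ?_, ?_⟩
    · rw [lt_div_iff₀ (by linarith)]
      linarith
    · rw [div_le_one (by linarith)]
      linarith
  have hvec : k4w122 = (2 * l) • k4ua a + (2 * (1 - l)) • k4tri := by
    funext i
    fin_cases i <;> simp [k4w122, k4ua, k4tri] <;> linarith
  have h1 : sval Δ k4w122 ≤ 2 * l * sval Δ (k4ua a) + 2 * (1 - l) * sval Δ k4tri := by
    rw [hvec]
    refine (sval_add_le hΔ _ _).trans (add_le_add ?_ ?_)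
    · exact sval_smul_le hΔ (by linarith) _
    · exact sval_smul_le hΔ (by linarith) _
  have h2 : 2 * l * sval Δ (k4ua a) ≤ 2 * l * 2 := mul_le_mul_of_nonneg_left hα (by linarith)
  unfold Cap
  nlinarith [h1, h2, hA, hB, hl0]

/-- **The cut of record as a forcing family** over any nonempty `Δ₀` and bounded lawful region. -/
theorem cut_forces {Δ₀ K : Set (Fin 6 → ℝ)} (hne : Δ₀.Nonempty)
    (hKb : ∀ u, BddAbove (dot u '' K)) {a : ℝ} (ha0 : 0 < a) (ha1 : a ≤ 1 / 2) :
    Forces Δ₀ K ([excessZeroData, residualPencilData 1, alphaCapData a].map LinData.holds)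
      (Cap k4tri 2) := by
  intro Δ h₀ hK hP
  have hΔ : Tame Δ := tame_of_between hne hKb h₀ hK
  exact cut_forces_cap hΔ ha0 ha1 (hP excessZeroData.holds (by simp))
    (hP (residualPencilData 1).holds (by simp)) (hP (alphaCapData a).holds (by simp))

/-- the instance over the record box: mandatory set ⊇ the seven flattening points -/
theorem cut_forces_box {ωbar : ℝ} {Δ₀ : Set (Fin 6 → ℝ)} (hne : Δ₀.Nonempty) {a : ℝ}
    (ha0 : 0 < a) (ha1 : a ≤ 1 / 2) :
    Forces Δ₀ (k4box ωbar)
      ([excessZeroData, residualPencilData 1, alphaCapData a].map LinData.holds) (Cap k4tri 2) :=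
  cut_forces hne (k4box_bddAbove ωbar) ha0 ha1

/-- slack of the value direction `(a,1,1,0,0,0)` at `x₀`: `(2a+4)/3 < 2 = ⟨(a,1,1,0,0,0), s₂⟩`
for `a < 1` -/
theorem slack_k4ua {Δ₀ : Set (Fin 6 → ℝ)} (hΔ : Tame Δ₀) (hface : ∀ q ∈ k4face, q ∈ Δ₀) {a : ℝ}
    (ha : a < 1) : dot (k4ua a) k4x0 < sval Δ₀ (k4ua a) := by
  have hf : dot (k4ua a) k4s2 ≤ sval Δ₀ (k4ua a) := le_sval hΔ _ (hface k4s2 (by simp [k4face]))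
  have e1 : dot (k4ua a) k4x0 = (2 * a + 4) / 3 := by
    rw [dot6]; simp [k4ua, k4x0]; ring
  have e2 : dot (k4ua a) k4s2 = 2 := by
    rw [dot6]; simp [k4ua, k4s2]; norm_num
  rw [e1]
  linarith

/-- slack of `x₀` in the faithful `TetraExcessZero`: `⟨𝟙,x₀⟩ = 7/2 < 4` (the other direction has a
negative coefficient); hence the piece is STABLE -/
theorem excessZero_stable {Δ₀ : Set (Fin 6 → ℝ)} (hΔ : Tame Δ₀) (hface : ∀ q ∈ k4face, q ∈ Δ₀)
    (hnec : excessZeroData.holds Δ₀) : StableAlong Δ₀ (pts k4pert) excessZeroData.holds := by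
  apply excessZeroData.stable_of_slack hΔ hnec k4pert
  · intro xv hxv u
    simp only [k4pert, List.mem_singleton] at hxv
    subst hxv
    exact k4x0_dominated hΔ hface u
  · intro xv hxv j hj _
    simp only [k4pert, List.mem_singleton] at hxv
    subst hxv
    fin_cases j
    · exact slack_k4one hΔ hface
    · exfalso
      have hj' : (0 : ℝ) < -1 := hj
      linarith

/-- the value piece `ω(1,a,1) ≤ 2` is STABLE for every `a < 1` -/
theorem alphaCap_stable {Δ₀ : Set (Fin 6 → ℝ)} (hΔ : Tame Δ₀) (hface : ∀ q ∈ k4face, q ∈ Δ₀)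
    {a : ℝ} (ha : a < 1) (hnec : (alphaCapData a).holds Δ₀) :
    StableAlong Δ₀ (pts k4pert) (alphaCapData a).holds := by
  apply (alphaCapData a).stable_of_slack hΔ hnec k4pert
  · intro xv hxv u
    simp only [k4pert, List.mem_singleton] at hxv
    subst hxv
    exact k4x0_dominated hΔ hface u
  · intro xv hxv j _ _
    simp only [k4pert, List.mem_singleton] at hxv
    subst hxv
    fin_cases j
    exact slack_k4ua hΔ hface ha

/-- **The ω-free part of the cut does not force** (`TetraExcessZero + ω(1,a,1) ≤ 2`, `a < 1`):
by residual necessity, the forcing of `cut_forces` is carried by `TetraPlusTwo`. -/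
theorem excessZero_alphaCap_not_force {Δ₀ K : Set (Fin 6 → ℝ)} (hΔ : Tame Δ₀) (hK : Δ₀ ⊆ K)
    (hface : ∀ q ∈ k4face, q ∈ Δ₀) (hroom : ∀ᶠ ε in 𝓝[>] (0 : ℝ), k4x0 + ε • k4tri ∈ K)
    {a : ℝ} (ha : a < 1) (hnecA : excessZeroData.holds Δ₀) (hnecα : (alphaCapData a).holds Δ₀) :
    ¬ Forces Δ₀ K ([excessZeroData, alphaCapData a].map LinData.holds) (Cap k4tri 2) := by
  apply omegaFree_not_forces_k4 hΔ hK hface hroom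
  · intro D hD
    simp only [List.mem_cons, List.mem_nil_iff, or_false] at hD
    rcases hD with rfl | rfl
    · exact hnecA
    · exact hnecα
  · intro D hD j hj _
    simp only [List.mem_cons, List.mem_nil_iff, or_false] at hD
    rcases hD with rfl | rfl
    · fin_cases j
      · exact slack_k4one hΔ hface
      · exfalso
        have hj' : (0 : ℝ) < -1 := hj
        linarith
    · fin_cases j
      exact slack_k4ua hΔ hface ha

/-- a bound on the seven flattening points bounds the flat world's support value -/
theorem sval_k4flatSet_le {u : Fin 6 → ℝ} {M : ℝ} (h : ∀ q ∈ k4flat, dot u q ≤ M) :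
    sval k4flatSet u ≤ M :=
  sval_le k4flatSet_tame u (fun q hq => h q hq)

/-- `ω(K₄) = 4` in the flat world -/
theorem sval_k4flatSet_one : sval k4flatSet k4one = 4 := by
  apply le_antisymm
  · apply sval_k4flatSet_le
    intro q hq
    simp only [k4flat, List.mem_cons, List.mem_nil_iff, or_false] at hq
    rcases hq with rfl | rfl | rfl | rfl | rfl | rfl | rfl <;>
      (rw [dot6]; simp [k4one, k4s0, k4s1, k4s2, k4s3, k4f1, k4f2, k4f3]) <;> norm_num
  · have h := le_sval k4flatSet_tame k4one (show k4f1 ∈ k4flatSet by simp [k4flatSet, k4flat])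
    have e : dot k4one k4f1 = 4 := by rw [dot6]; simp [k4one, k4f1]; norm_num
    linarith

/-- **`TetraPlusTwo` is the unstable (ω-bounding, tight) member**: adjoining the exotic point
`x₀ + ε·tri` to the flat world breaks it for every small `ε > 0`. -/
theorem plusTwo_unstable : ¬ StableAlong k4flatSet (pts k4pert) (residualPencilData 1).holds := by
  intro hst
  have hsmall : ∀ᶠ ε in 𝓝[>] (0 : ℝ), 0 < ε ∧ ε < 1 / 6 := by
    filter_upwards [Ioo_mem_nhdsGT (show (0 : ℝ) < 1 / 6 by norm_num)] with ε hε using hε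
  obtain ⟨ε, ⟨hε0, hε6⟩, hholds⟩ := (hsmall.and hst).exists
  rw [plusTwo_holds_iff] at hholds
  have h1 : 2 + ε * 3 ≤ sval (k4flatSet ∪ pts k4pert ε) k4tri := by
    have h := dot_le_sval_union k4flatSet_tame (pts_finite k4pert ε) k4tri
      (mem_pts ε (xv := (k4x0, k4tri)) (by simp [k4pert]))
    simp only at h
    rwa [dot_add_smul, dot_k4tri_x0, dot_k4tri_tri] at h
  have h2 : sval (k4flatSet ∪ pts k4pert ε) k4one ≤ 4 := by
    apply sval_union_le k4flatSet_tame sval_k4flatSet_one.le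
    intro p hp
    obtain ⟨xv, hxv, rfl⟩ := exists_of_mem_pts hp
    simp only [k4pert, List.mem_singleton] at hxv
    subst hxv
    simp only
    have e1 : dot k4one k4x0 = 7 / 2 := by rw [dot6]; simp [k4one, k4x0]; norm_num
    have e2 : dot k4one k4tri = 3 := by rw [dot6]; simp [k4one, k4tri]; norm_num
    rw [dot_add_smul, e1, e2]
    linarith
  linarith

end Cut

/-! ### 9. Finiteness is sharp: the infinite stable family `{ω(1,a,1) ≤ 2 : a < 1}` forces -/

section Finiteness

/-- every member of the family is NECESSARY (true at the flat world, `a ≤ 1`) -/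
theorem alphaCap_nec {a : ℝ} (ha : a ≤ 1) : (alphaCapData a).holds k4flatSet := by
  rw [alphaCap_holds_iff]
  apply sval_k4flatSet_le
  intro q hq
  simp only [k4flat, List.mem_cons, List.mem_nil_iff, or_false] at hq
  rcases hq with rfl | rfl | rfl | rfl | rfl | rfl | rfl <;>
    (rw [dot6]; simp [k4ua, k4s0, k4s1, k4s2, k4s3, k4f1, k4f2, k4f3]) <;> linarith

/-- **Finiteness is sharp.**  In every tame world whose `01`-coordinates are `≤ 1` (a pointwise law),
the infinite family `{ω(1,a,1) ≤ 2 : a < 1}` forces `ω ≤ 2` — although every member is necessary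
(`alphaCap_nec`) and stable (`alphaCap_stable`), i.e. ω-free in the sense of parts 1–3. -/
theorem alphaFamily_forces_cap {Δ : Set (Fin 6 → ℝ)} (hΔ : Tame Δ) (hbox : ∀ β ∈ Δ, β 0 ≤ 1)
    (h : ∀ a < 1, (alphaCapData a).holds Δ) : Cap k4tri 2 Δ := by
  unfold Cap
  apply sval_le hΔ
  intro β hβ
  refine le_of_forall_pos_le_add (fun δ hδ => ?_)
  have hcap := h (1 - δ) (by linarith)
  rw [alphaCap_holds_iff] at hcap
  have h1 : dot (k4ua (1 - δ)) β ≤ 2 := (le_sval hΔ _ hβ).trans hcap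
  have e : dot k4tri β = dot (k4ua (1 - δ)) β + δ * β 0 := by
    rw [dot6, dot6]; simp [k4tri, k4ua]; ring
  rw [e]
  nlinarith [hbox β hβ, hδ]

/-- the infinite family as a forcing family over every record box -/
theorem alphaFamily_forces {Δ₀ K : Set (Fin 6 → ℝ)} (hne : Δ₀.Nonempty) {ωbar : ℝ}
    (hK : K ⊆ k4box ωbar) :
    ∀ Δ : Set (Fin 6 → ℝ), Δ₀ ⊆ Δ → Δ ⊆ K → (∀ a < 1, (alphaCapData a).holds Δ) →
      Cap k4tri 2 Δ := by
  intro Δ h₀ hΔK h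
  have hΔ : Tame Δ := tame_of_subset_k4box (hne.mono h₀) (hΔK.trans hK)
  exact alphaFamily_forces_cap hΔ (fun β hβ => ((hK (hΔK hβ)).1 0).2) h

/-- the limit member `a = 1` of the family is the summit direction itself -/
theorem k4ua_one : k4ua 1 = k4tri := by
  funext i
  fin_cases i <;> simp [k4ua, k4tri]

/-- **… and the family is `ω = 2` in costume**: in lawful worlds (coordinates in `[0,1]`) the
infinite family `{ω(1,a,1) ≤ 2 : a < 1}` is EQUIVALENT to the cap `ω ≤ 2`. -/
theorem alphaFamily_iff_cap {Δ : Set (Fin 6 → ℝ)} {ωbar : ℝ} (hne : Δ.Nonempty)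
    (hK : Δ ⊆ k4box ωbar) : (∀ a < 1, (alphaCapData a).holds Δ) ↔ Cap k4tri 2 Δ := by
  have hΔ : Tame Δ := tame_of_subset_k4box hne hK
  refine ⟨alphaFamily_forces_cap hΔ (fun β hβ => ((hK hβ).1 0).2), fun hcap a ha => ?_⟩
  rw [alphaCap_holds_iff]
  refine le_trans (sval_le hΔ _ (fun β hβ => ?_)) hcap
  have hb0 : 0 ≤ β 0 := ((hK hβ).1 0).1
  have e : dot (k4ua a) β = dot k4tri β - (1 - a) * β 0 := by
    rw [dot6, dot6]; simp [k4tri, k4ua]; ring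
  rw [e]
  have h1 := le_sval hΔ k4tri hβ
  nlinarith [mul_nonneg (show (0 : ℝ) ≤ 1 - a by linarith) hb0]

/-- **Infinite families escape only by accumulating tightness at the summit face.**  If an
arbitrary family of caps `sval Δ (u i) ≤ r i`, each true at `Δ₀`, forces `ω ≤ 2` (room along
`x₀ + ε·tri`), then for every small `ε > 0` some member is `ε`-tight at the exotic point:
`0 ≤ r i - ⟨u i, x₀⟩ < ε·⟨u i, tri⟩` (in particular it sees `ω`: `⟨u i, tri⟩ > 0`).  For the family
`{ω(1,a,1) ≤ 2}` the gap is `2(1-a)/3 → 0`; for a finite family a member is exactly tight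
(part 2, `k4_residual_necessity`). -/
theorem capFamily_forces_nearly_tight {Δ₀ K : Set (Fin 6 → ℝ)} (hΔ : Tame Δ₀) (hK : Δ₀ ⊆ K)
    (hface : ∀ q ∈ k4face, q ∈ Δ₀) (hroom : ∀ᶠ ε in 𝓝[>] (0 : ℝ), k4x0 + ε • k4tri ∈ K)
    {I : Type*} (u : I → Fin 6 → ℝ) (r : I → ℝ) (hnec : ∀ i, sval Δ₀ (u i) ≤ r i)
    (hF : ∀ Δ : Set (Fin 6 → ℝ), Δ₀ ⊆ Δ → Δ ⊆ K → (∀ i, Cap (u i) (r i) Δ) → Cap k4tri 2 Δ) :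
    ∀ᶠ ε in 𝓝[>] (0 : ℝ), ∃ i, dot (u i) k4x0 ≤ r i ∧
      r i < dot (u i) k4x0 + ε * dot (u i) k4tri := by
  filter_upwards [hroom, self_mem_nhdsWithin] with ε hεK hε
  have hε' : (0 : ℝ) < ε := hε
  by_contra hcon
  push Not at hcon
  have hpts : pts k4pert ε ⊆ K := by
    intro p hp
    obtain ⟨xv, hxv, rfl⟩ := exists_of_mem_pts hp
    simp only [k4pert, List.mem_singleton] at hxv
    subst hxv
    exact hεK
  have hcaps : ∀ i, Cap (u i) (r i) (Δ₀ ∪ pts k4pert ε) := by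
    intro i
    show sval (Δ₀ ∪ pts k4pert ε) (u i) ≤ r i
    apply sval_union_le hΔ (hnec i)
    intro p hp
    obtain ⟨xv, hxv, rfl⟩ := exists_of_mem_pts hp
    simp only [k4pert, List.mem_singleton] at hxv
    subst hxv
    simp only
    rw [dot_add_smul]
    exact hcon i ((k4x0_dominated hΔ hface (u i)).trans (hnec i))
  have hcap := hF _ subset_union_left (union_subset hK hpts) hcaps
  have h1 := dot_le_sval_union hΔ (pts_finite k4pert ε) k4tri
    (mem_pts ε (xv := (k4x0, k4tri)) (by simp [k4pert]))
  simp only at h1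
  rw [dot_add_smul, dot_k4tri_x0, dot_k4tri_tri] at h1
  have hcap' : sval (Δ₀ ∪ pts k4pert ε) k4tri ≤ 2 := hcap
  linarith

end Finiteness

end Summit.MatrixMultiplication.MatrixMultiplication.Theorems.TetraResidualNecessity
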